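import Literature.AlgebraicGeometry.Frobenioids.RationalFunctionMonoidStrEquivalence
import Literature.IUT.HodgeTheaters.GlobalFrobenioidsGaloisChart
import HarnessLib

/-!
# [IUTchI] Example 5.1 (iv): `𝒪^×(A^birat)` for `A ∈ Ob(†ℱ^⊛)` IS the multiplicative group of the number field
# corresponding to `A` — for `†ℱ^⊛` ITSELF (any category equivalent to `ℱ^⊛(†𝒟^⊚)`), naturally in `A` and
# compatibly with divisors

S. Mochizuki, *Inter-universal Teichmüller theory I*, §5, Example 5.1 (iv), kurims manuscript (May 2020) p. 126
l. 18–21 (own render of the kurims PDF, `cat -n` numbering) [claim: Mochizuki2012, status: disputed]: "Thus, if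
`A ∈ Ob(†ℱ^⊛)`, then `𝒪^×(A^birat)` may be naturally identified with the multiplicative group of nonzero elements of
the number field [i.e., finite extension of `F_mod`] corresponding to `A`."; (iii) p. 125 l. 47: "Let `†ℱ^⊛` be any
category equivalent to `ℱ^⊛(†𝒟^⊚)`."; (iii) p. 126 l. 5–12: "`†ℱ^⊛_mod := †ℱ^⊛|_{terminal objects}` […] the
restriction of `†ℱ^⊛` to the full subcategory of `†𝒟^⊛` determined by the terminal objects [i.e., "`C_{F_mod}`"] of
`†𝒟^⊛`. […] the Frobenioid `†ℱ^⊛_mod` may be thought of as the Frobenioid of arithmetic line bundles on the stack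
"`S_mod`" of Remark 3.1.5."  (`𝒪^×(A^birat)` is [FrdI] Prop 4.4's group of units of the birationalization; the
Lean names below are ours, not print's.)

STATE OF THE TREE.  abc-iut-L5-t1 types `†ℱ^⊛` as `GlobalFrobenioid Δ Dcirc toBase0` (a category `cat` WITH an
equivalence `equiv : cat ≌ ℱ^⊛(†𝒟^⊚)` to abc-iut-L1's model Frobenioid of the divisor data `Δ = (Φ^⊛, 𝔹, Div)`,
`GlobalFrobenioidsModel.lean`); its Frobenioid structure is the induced one `equiv.functor ⋙ toElem`
(`GlobalFrobenioid.isFrobenioid_equivToElem`, abc-iut-w4-d050).  For the MODEL `ℱ^⊛(†𝒟^⊚)` the sentence above is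
abc-iut-L1's [FrdI] Thm 5.2 (ii) "Moreover" (`ModelFrobenioid.rationalFunctionMonoidIsB_holds`: `𝔹` IS the
rational-function monoid `A ↦ 𝒪^×(A^birat)` — L1's explicit `PreFrobenioid.BiratUnits`, [FrdI] Prop 4.4 —
naturally and compatibly with the divisor maps, packaged as `PreFrobenioid.RationalFunctionMonoidStr`),
instantiated at the arithmetic models by `GlobalDivisorData.nonempty_rationalFunctionMonoidStr_arith` /
`_arithAlong` / `_ofChart` (w4-d050), where `𝔹(A) = (F̄^{Stab(a_A)})^×` by `rfl` (`arith_B_obj`, `arithAlong_B_obj`).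

THIS FILE (proof-only, 0 `def`s) carries the identification from the model to `†ℱ^⊛` ITSELF along `equiv`, by
the units clause of [FrdI] Cor 4.10 in the form `RationalFunctionMonoidStr.nonempty_precomp_equivalence`
(`Frobenioids/RationalFunctionMonoidStrEquivalence.lean`) [cite: MochizukiFrdI2008, Cor. 4.10 p.90]:
* `GlobalFrobenioid.nonempty_rationalFunctionMonoidStr_equivToElem` — for EVERY `†ℱ^⊛ : GlobalFrobenioid Δ …` under
  the [FrdI] Thm 5.2 hypotheses on `(Φ^⊛, 𝔹)`: `𝔹(A_D) ≅ 𝒪^×(A^birat)` for all `A ∈ Ob(†ℱ^⊛)`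
  (`A_D := Base(equiv A)`, identified with `Base_{†𝒟^⊛}(A)` by t1's `toBase_compat`,
  `nonempty_base_equiv_iso_identify`), compatibly with `Div` and naturally along linear morphisms of `†ℱ^⊛`
  ([FrdI] Prop 2.2 (ii)); object-level reading `exists_mulEquiv_biratUnits_equivToElem`;
* `…_arith`, `…_arithAlong`, `…_ofChart` — UNCONDITIONAL at the arithmetic models (hypotheses discharged by
  `arith_hypotheses` / `arithAlong_hypotheses` / `ofChart_hypotheses`), with the units reading
  `exists_units_mulEquiv_biratUnits_arith` / `_arithAlong` / `_ofChart`: `𝒪^×(A^birat) ≅ (F̄^{Stab(a_{A_D})})^×`,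
  "the multiplicative group of nonzero elements of the number field […] corresponding to `A`", compatibly with
  `div`;
* `nonempty_units_mulEquiv_biratUnits_arith_overTerminal` — `†ℱ^⊛_mod` ((iii) p. 126): for `A` over a terminal object
  "`C_{F_mod}`" of `†𝒟^⊛`, `𝒪^×(A^birat) ≅ F_mod^×` (the field of a terminal object is the bottom field,
  `arith_field_terminal`).

Nothing of [IUTchI] is asserted beyond this bookkeeping identity; no new Prop fact; no side is taken on
[IUTchIII] Cor. 3.12.  Mathematics: [cite: MochizukiFrdI2008, Cor. 4.10 p.90],
[cite: MochizukiFrdI2008, Thm. 5.2(ii) p.101], [cite: MochizukiFrdI2008, Prop. 4.4(ii) p.83].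
-/

noncomputable section

namespace Literature.IUT.HodgeTheaters

open CategoryTheory Opposite Literature.AlgebraicGeometry.Frobenioids
open Literature.AlgebraicGeometry.Frobenioids.QuasiTemperoid

universe u

namespace GlobalFrobenioid

section General

variable {G : ProfiniteGrp.{u}} {Δ : GlobalDivisorData G} {Dcirc : Type (u + 1)} [Category.{u} Dcirc]
  {toBase0 : Dcirc ⥤ BaseCat G} (F : GlobalFrobenioid Δ Dcirc toBase0)

/-- **[IUTchI] Ex 5.1 (iv) for `†ℱ^⊛` ITSELF, under the [FrdI] Thm 5.2 hypotheses on `(Φ^⊛, 𝔹)`**: for the given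
equivalence `equiv : †ℱ^⊛ ≌ ℱ^⊛(†𝒟^⊚)` and the induced Frobenioid structure on `†ℱ^⊛`, the rational-function monoid
`A ↦ 𝒪^×(A^birat)` (`A ∈ Ob(†ℱ^⊛)`) IS `𝔹 = (A_D ↦ 𝕄^⊛(†𝒟^⊚)^{A_D})` — isomorphisms `𝔹(A_D) ≅ 𝒪^×(A^birat)`,
`A_D = Base(equiv A)` (`= Base_{†𝒟^⊛}(A)` by `toBase_compat`), compatible with `Div` and natural along linear
morphisms ([FrdI] Thm 5.2 (ii) for the model, transported by [FrdI] Cor 4.10 along `equiv`).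
([IUTchI] Ex 5.1 (iv) p.126) [claim: Mochizuki2012, status: disputed] -/
theorem nonempty_rationalFunctionMonoidStr_equivToElem (h : ModelFrobenioid.Hypotheses Δ.Φ Δ.B) :
    Nonempty (PreFrobenioid.RationalFunctionMonoidStr
      (F.equiv.functor ⋙ ModelFrobenioid.toElem Δ.Φ Δ.B Δ.div)
      (F.isFrobenioid_equivToElem h.isMonoidOn h.isDivisorial h.isMonoidOn_rat h.isGroupLike_rat) Δ.B Δ.div) := by
  obtain ⟨S⟩ := ModelFrobenioid.rationalFunctionMonoidIsB_holds Δ.Φ Δ.B Δ.div h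
    (Δ.isFrobenioid_model h.isMonoidOn h.isDivisorial h.isMonoidOn_rat h.isGroupLike_rat)
  exact PreFrobenioid.RationalFunctionMonoidStr.nonempty_precomp_equivalence F.equiv _ _ S

/-- Object-level reading of the above: for every `A ∈ Ob(†ℱ^⊛)` an isomorphism `𝔹(A_D) ≅ 𝒪^×(A^birat)` carrying the
given `𝕄^⊛(†𝒟^⊚)^{A_D} → Φ^⊛(A_D)^gp` to the divisor map `𝒪^×(A^birat) → Φ^⊛(A_D)^gp` of [FrdI] Prop 4.4 (iii).
([IUTchI] Ex 5.1 (iv) p.126) [claim: Mochizuki2012, status: disputed] -/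
theorem exists_mulEquiv_biratUnits_equivToElem (h : ModelFrobenioid.Hypotheses Δ.Φ Δ.B) (A : F.cat) :
    ∃ ι : Δ.B.obj (op (F.equiv.functor.obj A).base) ≃*
        PreFrobenioid.BiratUnits (F.equiv.functor ⋙ ModelFrobenioid.toElem Δ.Φ Δ.B Δ.div)
          (F.isFrobenioid_equivToElem h.isMonoidOn h.isDivisorial h.isMonoidOn_rat h.isGroupLike_rat) A,
      ∀ b, PreFrobenioid.BiratUnits.divHom _ A (ι b) = (Δ.div.app (op (F.equiv.functor.obj A).base)).hom b := by
  obtain ⟨S⟩ := F.nonempty_rationalFunctionMonoidStr_equivToElem h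
  exact ⟨S.iso A, S.div_iso A⟩

/-- `A_D`: the base of `equiv A` in the model IS the base of `A` in `†𝒟^⊛` through t1's identification
`Base(†ℱ^⊛) ⥲ †𝒟^⊛` (the recorded `toBase_compat`), so "the number field corresponding to `A`" is unambiguous.
([IUTchI] Ex 5.1 (iii) p.125) [claim: Mochizuki2012, status: disputed] -/
theorem nonempty_base_equiv_iso_identify (A : F.cat) :
    Nonempty ((F.equiv.functor.obj A).base ≅ F.identify.functor.obj (F.toBase.obj A)) :=
  ⟨(F.toBase_compat.app A).symm⟩

end General

/-! ### Unconditional instances at the arithmetic models -/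

section Arith

variable {F₀ : Type} [Field F₀] [NumberField F₀] {Dcirc : Type 1} [Category.{0} Dcirc]
  {toBase0 : Dcirc ⥤ BaseCat (absGalGrp F₀)} (𝓕 : GlobalFrobenioid (GlobalDivisorData.arith F₀) Dcirc toBase0)

/-- **[IUTchI] Ex 5.1 (iv) for `†ℱ^⊛` itself — UNCONDITIONAL at the arithmetic model `π₁(†𝒟^⊛) = G_{F_mod}`**:
`𝔹 = (A ↦ (F̄^{Stab(a_A)})^×)` with `div` IS the rational-function monoid `A ↦ 𝒪^×(A^birat)` of ANY `†ℱ^⊛`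
equivalent to `ℱ^⊛(†𝒟^⊚)`, naturally and compatibly with divisors.
([IUTchI] Ex 5.1 (iv) p.126) [claim: Mochizuki2012, status: disputed] -/
theorem nonempty_rationalFunctionMonoidStr_equivToElem_arith :
    Nonempty (PreFrobenioid.RationalFunctionMonoidStr
      (𝓕.equiv.functor ⋙ ModelFrobenioid.toElem _ _ (GlobalDivisorData.arith F₀).div)
      𝓕.isFrobenioid_equivToElem_arith (GlobalDivisorData.arith F₀).B (GlobalDivisorData.arith F₀).div) :=
  𝓕.nonempty_rationalFunctionMonoidStr_equivToElem (GlobalDivisorData.arith_hypotheses F₀)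

/-- … read on objects: for `A ∈ Ob(†ℱ^⊛)` over `A_D ∈ Ob(†𝒟^⊛)`, `𝒪^×(A^birat) ≅ (F̄^{Stab(a_{A_D})})^×` — "the
multiplicative group of nonzero elements of the number field […] corresponding to `A`" — carrying `f ↦ div f`
([FrdI] Ex 6.3) to the divisor map of `𝒪^×(A^birat)`. ([IUTchI] Ex 5.1 (iv) p.126) [claim: Mochizuki2012, status: disputed] -/
theorem exists_units_mulEquiv_biratUnits_arith (A : 𝓕.cat) :
    ∃ ι : (↥(fixFld F₀ ((BCat.connectedToBTemp (GalFbar F₀)).obj (𝓕.equiv.functor.obj A).base)))ˣ ≃*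
        PreFrobenioid.BiratUnits (𝓕.equiv.functor ⋙ ModelFrobenioid.toElem _ _ (GlobalDivisorData.arith F₀).div)
          𝓕.isFrobenioid_equivToElem_arith A,
      ∀ b, PreFrobenioid.BiratUnits.divHom _ A (ι b) =
        ((GlobalDivisorData.arith F₀).div.app (op (𝓕.equiv.functor.obj A).base)).hom b :=
  𝓕.exists_mulEquiv_biratUnits_equivToElem (GlobalDivisorData.arith_hypotheses F₀) A

/-- **`†ℱ^⊛_mod`** (Ex 5.1 (iii) p. 126: `†ℱ^⊛_mod := †ℱ^⊛|_{terminal objects}`, "the Frobenioid of arithmetic line bundles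
on the stack "`S_mod`""): for `A ∈ Ob(†ℱ^⊛)` over a terminal object of `†𝒟^⊛` (t1's `overTerminal`), the rational
functions of `A` are those of `S_mod` — in our words **`𝒪^×(A^birat) ≅ F_mod^×`** — at the arithmetic model (`F₀` in the
role of `F_mod`; the number field of a terminal object is the bottom field, `arith_field_terminal`).
([IUTchI] Ex 5.1 (iv) p.126) [claim: Mochizuki2012, status: disputed] -/
theorem nonempty_units_mulEquiv_biratUnits_arith_overTerminal (A : 𝓕.cat) (hA : 𝓕.overTerminal A) :
    Nonempty (F₀ˣ ≃*
      PreFrobenioid.BiratUnits (𝓕.equiv.functor ⋙ ModelFrobenioid.toElem _ _ (GlobalDivisorData.arith F₀).div)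
        𝓕.isFrobenioid_equivToElem_arith A) := by
  obtain ⟨hT⟩ := hA
  have hterm : Limits.IsTerminal (𝓕.equiv.functor.obj A).base := hT.ofIso (𝓕.toBase_compat.app A)
  have hbot : ((galoisSubextOfFinite F₀).obj (𝓕.equiv.functor.obj A).base).L = ⊥ :=
    arith_field_terminal F₀ hterm
  obtain ⟨ι, -⟩ := 𝓕.exists_units_mulEquiv_biratUnits_arith A
  have j : F₀ ≃ₐ[F₀] ↥((galoisSubextOfFinite F₀).obj (𝓕.equiv.functor.obj A).base).L :=
    (IntermediateField.botEquiv F₀ (Fbar F₀)).symm.trans (IntermediateField.equivOfEq hbot.symm)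
  exact ⟨(Units.mapEquiv j.toMulEquiv).trans ι⟩

end Arith

section ArithAlong

variable {G : ProfiniteGrp.{0}} {F₀ : Type} [Field F₀] [NumberField F₀] {ρ : G →ₜ* GalFbar F₀}
  {hρ : Function.Surjective ρ} {Dcirc : Type 1} [Category.{0} Dcirc] {toBase0 : Dcirc ⥤ BaseCat G}
  (𝓕 : GlobalFrobenioid (GlobalDivisorData.arithAlong F₀ ρ hρ) Dcirc toBase0)

/-- **[IUTchI] Ex 5.1 (iv) for `†ℱ^⊛` itself — UNCONDITIONAL over a general `†𝒟^⊛ = ℬ(π₁(†𝒟^⊛))⁰` acting through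
`ρ : π₁(†𝒟^⊛) ↠ G_{F_mod}`**: `𝔹 = (A ↦ (𝕄̄^⊛(†𝒟^⊚)^A)^×)` with `div` IS the rational-function monoid of ANY `†ℱ^⊛`
equivalent to `ℱ^⊛(†𝒟^⊚)`. ([IUTchI] Ex 5.1 (iv) p.126) [claim: Mochizuki2012, status: disputed] -/
theorem nonempty_rationalFunctionMonoidStr_equivToElem_arithAlong :
    Nonempty (PreFrobenioid.RationalFunctionMonoidStr
      (𝓕.equiv.functor ⋙ ModelFrobenioid.toElem _ _ (GlobalDivisorData.arithAlong F₀ ρ hρ).div)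
      𝓕.isFrobenioid_equivToElem_arithAlong (GlobalDivisorData.arithAlong F₀ ρ hρ).B
      (GlobalDivisorData.arithAlong F₀ ρ hρ).div) :=
  𝓕.nonempty_rationalFunctionMonoidStr_equivToElem (GlobalDivisorData.arithAlong_hypotheses F₀ ρ hρ)

/-- … read on objects: `𝒪^×(A^birat) ≅ (𝕄̄^⊛(†𝒟^⊚)^{A_D})^×`, the unit group of "the corresponding subfield"
(`subfieldFunctor ρ`), compatibly with `div`. ([IUTchI] Ex 5.1 (iv) p.126) [claim: Mochizuki2012, status: disputed] -/
theorem exists_units_mulEquiv_biratUnits_arithAlong (A : 𝓕.cat) :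
    ∃ ι : (↥((subfieldFunctor F₀ ρ hρ).obj (𝓕.equiv.functor.obj A).base).L)ˣ ≃*
        PreFrobenioid.BiratUnits
          (𝓕.equiv.functor ⋙ ModelFrobenioid.toElem _ _ (GlobalDivisorData.arithAlong F₀ ρ hρ).div)
          𝓕.isFrobenioid_equivToElem_arithAlong A,
      ∀ b, PreFrobenioid.BiratUnits.divHom _ A (ι b) =
        ((GlobalDivisorData.arithAlong F₀ ρ hρ).div.app (op (𝓕.equiv.functor.obj A).base)).hom b :=
  𝓕.exists_mulEquiv_biratUnits_equivToElem (GlobalDivisorData.arithAlong_hypotheses F₀ ρ hρ) A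

end ArithAlong

section OfChart

variable {N : NFBridgeRecon.{0}} {F₀ : Type} [Field F₀] [NumberField F₀] {c : N.GaloisChart F₀}
  {Dcirc : Type 1} [Category.{0} Dcirc] {toBase0 : Dcirc ⥤ BaseCat N.piDast}
  (𝓕 : GlobalFrobenioid (GlobalDivisorData.ofChart c) Dcirc toBase0)

/-- **[IUTchI] Ex 5.1 (iv) for `†ℱ^⊛` itself — UNCONDITIONAL for the divisor data of a Galois chart of the
(i)-data `𝕄̄^⊛(†𝒟^⊚)`** (`GlobalDivisorData.ofChart`). ([IUTchI] Ex 5.1 (iv) p.126) [claim: Mochizuki2012, status: disputed] -/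
theorem nonempty_rationalFunctionMonoidStr_equivToElem_ofChart :
    Nonempty (PreFrobenioid.RationalFunctionMonoidStr
      (𝓕.equiv.functor ⋙ ModelFrobenioid.toElem _ _ (GlobalDivisorData.ofChart c).div)
      𝓕.isFrobenioid_equivToElem_ofChart (GlobalDivisorData.ofChart c).B (GlobalDivisorData.ofChart c).div) :=
  𝓕.nonempty_rationalFunctionMonoidStr_equivToElem (GlobalDivisorData.ofChart_hypotheses c)

/-- … read on objects: `𝒪^×(A^birat) ≅ (𝕄̄^⊛(†𝒟^⊚)^{A_D})^×` for the chart's subfields, compatibly with `div`.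
([IUTchI] Ex 5.1 (iv) p.126) [claim: Mochizuki2012, status: disputed] -/
theorem exists_units_mulEquiv_biratUnits_ofChart (A : 𝓕.cat) :
    ∃ ι : (↥((subfieldFunctor F₀ c.ρ c.surjective).obj (𝓕.equiv.functor.obj A).base).L)ˣ ≃*
        PreFrobenioid.BiratUnits
          (𝓕.equiv.functor ⋙ ModelFrobenioid.toElem _ _ (GlobalDivisorData.ofChart c).div)
          𝓕.isFrobenioid_equivToElem_ofChart A,
      ∀ b, PreFrobenioid.BiratUnits.divHom _ A (ι b) =
        ((GlobalDivisorData.ofChart c).div.app (op (𝓕.equiv.functor.obj A).base)).hom b :=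
  𝓕.exists_mulEquiv_biratUnits_equivToElem (GlobalDivisorData.ofChart_hypotheses c) A

end OfChart

end GlobalFrobenioid

end Literature.IUT.HodgeTheaters

end
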